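import Literature.AlgebraicGeometry.Motives.AbelianVarietyDihedralOrderEightBrauerRelations
import Mathlib.GroupTheory.SpecificGroups.Quaternion
import HarnessLib

/-!
# The Brauer relation lattice of the dicyclic group `Dic_3 = C_3 ⋊ C_4 = Q_12` in full: `K(Dic_3) = ℤ·Θ_inf`,
# `Θ_inf = Z − 2C_4 − C_6 + 2Dic_3` lifted from `Dic_3/Z ≅ S_3` — every relation is imprimitive, `Prim(Dic_3) = 0`

Layer A1/A2 of the Hodge foundations lane (`lit-hodgefound`, row A1-20⁺ · A2, seat p03 generation 28, row g28-#11) on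
the ALGEBRAIC carrier; sequel of `Motives/AbelianVarietyDihedralOrderEightBrauerRelations` (g28-#2; same method;
CONSUMED: `indClassFun_one_apply_eq_div`, `card_conj_mem_bot`, `indClassFun_top_one`,
`mem_ker_linearCombination_indClassFun_one_iff`) and companion of `Motives/AbelianVarietyRelativePartitionIdempotentRelations`
§4 Part II (the Kani–Rosen isogeny of the dicyclic partition, `isIsogenous_dicyclic_of_odd`: `B_A^n × B_x^{2n} ∼ B_Z^n × B_G^{2n}`,
for `n = 3` the `3`-fold of the relation below — CITED, not restated).  After the five groups of order `8` (g28-#2,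
#4, #7, #8; `Prim ≠ 0` only for `D_4`) and `A_4` (g28-#9, `Prim ≅ ℤ`), the third non-abelian group of order `12`
(besides `A_4` and `D_6`): the dicyclic group `Dic_3 = ⟨a, x | a⁶ = 1, x² = a³, xax⁻¹ = a⁻¹⟩` (Mathlib's
`QuaternionGroup 3`).  Its subgroups up to conjugacy are `1, Z = ⟨a³⟩ = Z(G), C_3 = ⟨a²⟩, C_4 = ⟨x⟩ (one class: the
Sylow `2`-subgroups), C_6 = ⟨a⟩, Dic_3` — all proper subgroups CYCLIC, so (Bartel–Dokchitser §2: "the rank of `K(G)` is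
the number of conjugacy classes of non-cyclic subgroups") **`rank K(Dic_3) = 1`**; the class equations (§3) give
**`a ∈ K(Dic_3)` iff `a_1 = 0`, `a_Z = −a_{C_6}`, `a_{C_3} = 0`, `a_{C_4} = 2a_{C_6}`, `a_G = −2a_{C_6}`**, i.e.
**`K(Dic_3) = ℤ·Θ_inf`, `Θ_inf = Z − 2C_4 − C_6 + 2G`** — the INFLATION from `Dic_3/Z ≅ S_3` of Example 2's relation
`1 − 2C_2 − C_3 + 2S_3` (`C_4 ↦ C_2`, `C_6 ↦ C_3` under `G → G/Z`).  Hence every Brauer relation of `Dic_3` is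
imprimitive: **`Prim(Dic_3) = 0`**, consistent with Theorem A (in case (3) "the natural map `Q → Out S^d` is
injective" fails: `Q = C_4` acts on `S = C_3` through `C_4 ↠ C_2 = Aut C_3`).  Everything here is PROVED; NO
definition, NO named fact (net Literature debt 0).

## Sources, verbatim

A. Bartel, T. Dokchitser, *Brauer relations in finite groups*, J. Eur. Math. Soc. **17** (2015) (arXiv 1103.2047, held
`paper:arxiv-1103.2047`).  §1.1 Theorem A (p0003), case (3): "`G` is an extension `1 → S^d → G → Q → 1`, where `S` is
simple, `Q` is quasi-elementary, the natural map `Q → Out S^d` is injective […]".  §2 (p0006): "If `N ◁ G`, then a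
`G/N`-relation can be lifted to a `G`-relation"; "the number of isomorphism classes of […] is equal to the number of
conjugacy classes of cyclic subgroups […] the rank of `K(G)` is the number of conjugacy classes of non-cyclic
subgroups"; Example 2 (`S_3`: "`C_l ⋊ H − l·H − C_l + l·(C_l ⋊ H)`", here `1 − 2C_2 − C_3 + 2S_3`).

## Dictionary and what is proved (namespace `Literature.AlgebraicGeometry.Motives.AbelianVariety`)

Representatives `![1, Z, C_3, C_4, C_6, G] = ![⊥, zpowers (a 3), zpowers (a 2), zpowers (xa 0), zpowers (a 1), ⊤]` in
`QuaternionGroup 3`; classes described by `g = 1`, `g² = 1` (`{1, a³}`), `g³ = 1` (`{1, a², a⁴}`), `g⁶ = 1` (`⟨a⟩`),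
`g² = a³` (the six elements `xaⁱ`, of order `4`); `Θ_inf = ![0, 1, 0, -2, -1, 2]`; `𝒦` any `Submodule ℤ (Fin 6 → ℤ)`
with `a ∈ 𝒦 ↔ Σ_i a_i (1_{H_i})^G = 0`.

* §1 `orderOf_a_three_a_two_dicyclicThree`, `sq_eq_a_three_iff_dicyclicThree` (the `xaⁱ`), `natCard_subgroups_dicyclicThree`.
* §2 `card_conj_mem_center/_aSq/_xa/_a_dicyclicThree`, **`indClassFun_one_apply_dicyclicThree`**.
* §3 `sum_smul_indClassFun_dicyclicThree_apply`, **`sum_smul_indClassFun_dicyclicThree_eq_zero_iff`**,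
  **`thetaInf_mem_dicyclicThree`**, **`indClassFun_center_add_two_top_eq_dicyclicThree`** (`(1_Z)^G + 2(1_G)^G = 2(1_{C_4})^G + (1_{C_6})^G`).
* §4 `mem_brauerRelations_dicyclicThree_iff`, **`eq_smul_thetaInf_of_mem_brauerRelations_dicyclicThree`**,
  **`brauerRelations_dicyclicThree_eq_span_singleton`**, `linearIndependent_thetaInf_dicyclicThree`,
  `ker_linearCombination_indClassFun_one_dicyclicThree_eq_span`,
  **`finrank_ker_linearCombination_indClassFun_one_dicyclicThree`** (`= 1`).

## References

* [BartelDokchitser2015] A. Bartel, T. Dokchitser, *Brauer relations in finite groups*, JEMS 17 (2015), §1.1 Theorem A,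
  §2 (Inflation, rank, Example 2).
* [KaniRosen1989] E. Kani, M. Rosen, *Idempotent relations and factors of Jacobians*, Math. Ann. 284 (1989) (the
  isogenies, via the companion files).
-/

noncomputable section

universe u

open CategoryTheory CategoryTheory.Limits
open Literature.RepresentationTheory.FiniteGroups

namespace Literature.AlgebraicGeometry.Motives

namespace AbelianVariety

open QuaternionGroup

/-! ## §1 `Dic_3 = QuaternionGroup 3`: orders, the elements `xaⁱ`, subgroup orders -/

section DicyclicThreeGroup

/-- `a³ = x²` has order `2`, `a²` has order `3` (`⟨a³⟩ = Z(G)`, `⟨a²⟩ = C_3`). [cite: BartelDokchitser2015, §2 ("cyclic subgroups")] -/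
theorem orderOf_a_three_a_two_dicyclicThree :
    orderOf (a 3 : QuaternionGroup 3) = 2 ∧ orderOf (a 2 : QuaternionGroup 3) = 3 := by
  refine ⟨?_, ?_⟩
  · rw [orderOf_eq_prime_iff (p := 2)]
    decide
  · haveI : Fact (Nat.Prime 3) := ⟨Nat.prime_three⟩
    rw [orderOf_eq_prime_iff (p := 3)]
    decide

/-- The six elements outside `⟨a⟩` are the `xaⁱ`, characterised by `g² = a³`. [cite: BartelDokchitser2015, §2] -/
theorem sq_eq_a_three_iff_dicyclicThree (g : QuaternionGroup 3) :
    g ^ 2 = a 3 ↔ ∃ i : ZMod 6, g = xa i := by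
  revert g
  decide

/-- `y ∈ ⟨g⟩ ↔ y ∈ {g^k : k < orderOf g}`. [folklore] -/
private theorem mem_zpowers_q12_iff (g : QuaternionGroup 3) {m : ℕ} (hm : orderOf g = m) (y : QuaternionGroup 3) :
    y ∈ Subgroup.zpowers g ↔ y ∈ (Finset.range m).image (g ^ ·) := by
  rw [mem_zpowers_iff_mem_range_orderOf, hm]

end DicyclicThreeGroup

/-! ## §2 The marks and permutation characters of `Z, C_3, C_4, C_6`, machine-checked -/

section DicyclicThreeMarks

/-- `|{y : Q y}|` as a filter cardinality. [folklore] -/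
private theorem natCard_subtype_eq_card_filter_q12 (P : QuaternionGroup 3 → Prop) [DecidablePred P]
    (Q : QuaternionGroup 3 → Prop) (hQP : ∀ y, Q y ↔ P y) :
    Nat.card {y : QuaternionGroup 3 // Q y} = (Finset.univ.filter P).card := by
  rw [← Fintype.card_subtype, ← Nat.card_eq_fintype_card]
  exact Nat.card_congr (Equiv.subtypeEquivRight hQP)

/-- **Marks of `Z = ⟨a³⟩`**: `12·[g ∈ Z] = 12·[g² = 1]`. [cite: BartelDokchitser2015, §2] -/
theorem card_conj_mem_center_dicyclicThree (g : QuaternionGroup 3) :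
    Nat.card {y : QuaternionGroup 3 // y⁻¹ * g * y ∈ Subgroup.zpowers (a 3 : QuaternionGroup 3)} =
      if g ^ 2 = 1 then 12 else 0 := by
  classical
  rw [natCard_subtype_eq_card_filter_q12 _ _ fun y ↦ mem_zpowers_q12_iff _ orderOf_a_three_a_two_dicyclicThree.1 _]
  revert g
  decide

/-- **Marks of `C_3 = ⟨a²⟩ ⊴ G`**: `12·[g³ = 1]`. [cite: BartelDokchitser2015, §2] -/
theorem card_conj_mem_aSq_dicyclicThree (g : QuaternionGroup 3) :
    Nat.card {y : QuaternionGroup 3 // y⁻¹ * g * y ∈ Subgroup.zpowers (a 2 : QuaternionGroup 3)} =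
      if g ^ 3 = 1 then 12 else 0 := by
  classical
  rw [natCard_subtype_eq_card_filter_q12 _ _ fun y ↦ mem_zpowers_q12_iff _ orderOf_a_three_a_two_dicyclicThree.2 _]
  revert g
  decide

/-- **Marks of `C_4 = ⟨x⟩ = {1, x, a³, xa³}`**: `12` on `Z`, `4` on the six `xaⁱ` (`xaⁱ ~ xa^{i+2}`, and
`x⁻¹ = xa³`), `0` on `⟨a⟩ ∖ Z`. [cite: BartelDokchitser2015, §2] -/
theorem card_conj_mem_xa_dicyclicThree (g : QuaternionGroup 3) :
    Nat.card {y : QuaternionGroup 3 // y⁻¹ * g * y ∈ Subgroup.zpowers (xa 0 : QuaternionGroup 3)} =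
      if g ^ 2 = 1 then 12 else if g ^ 2 = a 3 then 4 else 0 := by
  classical
  rw [natCard_subtype_eq_card_filter_q12 _ _ fun y ↦ mem_zpowers_q12_iff _ (QuaternionGroup.orderOf_xa 0) _]
  revert g
  decide

/-- **Marks of `C_6 = ⟨a⟩ ⊴ G`**: `12·[g⁶ = 1]`. [cite: BartelDokchitser2015, §2] -/
theorem card_conj_mem_a_dicyclicThree (g : QuaternionGroup 3) :
    Nat.card {y : QuaternionGroup 3 // y⁻¹ * g * y ∈ Subgroup.zpowers (a 1 : QuaternionGroup 3)} =
      if g ^ 6 = 1 then 12 else 0 := by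
  classical
  rw [natCard_subtype_eq_card_filter_q12 _ _ fun y ↦ mem_zpowers_q12_iff _ QuaternionGroup.orderOf_a_one _]
  revert g
  decide

/-- The orders `2, 3, 4, 6` of `Z, C_3, C_4, C_6` and `|Dic_3| = 12`. [cite: BartelDokchitser2015, §2] -/
theorem natCard_subgroups_dicyclicThree :
    Nat.card (Subgroup.zpowers (a 3 : QuaternionGroup 3)) = 2 ∧ Nat.card (Subgroup.zpowers (a 2 : QuaternionGroup 3)) = 3 ∧
      Nat.card (Subgroup.zpowers (xa 0 : QuaternionGroup 3)) = 4 ∧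
      Nat.card (Subgroup.zpowers (a 1 : QuaternionGroup 3)) = 6 ∧ Nat.card (QuaternionGroup 3) = 12 := by
  refine ⟨?_, ?_, ?_, ?_, ?_⟩
  · rw [Nat.card_zpowers, orderOf_a_three_a_two_dicyclicThree.1]
  · rw [Nat.card_zpowers, orderOf_a_three_a_two_dicyclicThree.2]
  · rw [Nat.card_zpowers, QuaternionGroup.orderOf_xa]
  · rw [Nat.card_zpowers, QuaternionGroup.orderOf_a_one]
  · simp only [Nat.card_eq_fintype_card, QuaternionGroup.card, Nat.reduceMul]

/-- **The six permutation characters of `Dic_3` as explicit functions**: `(1_1)^G = 12δ_1`, `(1_Z)^G = 6·1_Z`,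
`(1_{C_3})^G = 4·1_{C_3}`, `(1_{C_4})^G`: `3` on `Z`, `1` on the `xaⁱ`, `0` else; `(1_{C_6})^G = 2·1_{⟨a⟩}`;
`(1_G)^G = 1`. [cite: BartelDokchitser2015, §1.1 ("Θ ∈ K(G) ⟺ Σ_i n_i Ind 1_{H_i} = 0")] -/
theorem indClassFun_one_apply_dicyclicThree (g : QuaternionGroup 3) :
    indClassFun (⊥ : Subgroup (QuaternionGroup 3)) 1 g = (if g = 1 then (12 : ℂ) else 0) ∧
    indClassFun (Subgroup.zpowers (a 3 : QuaternionGroup 3)) 1 g = (if g ^ 2 = 1 then (6 : ℂ) else 0) ∧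
    indClassFun (Subgroup.zpowers (a 2 : QuaternionGroup 3)) 1 g = (if g ^ 3 = 1 then (4 : ℂ) else 0) ∧
    indClassFun (Subgroup.zpowers (xa 0 : QuaternionGroup 3)) 1 g =
      (if g ^ 2 = 1 then (3 : ℂ) else if g ^ 2 = a 3 then 1 else 0) ∧
    indClassFun (Subgroup.zpowers (a 1 : QuaternionGroup 3)) 1 g = (if g ^ 6 = 1 then (2 : ℂ) else 0) ∧
    indClassFun (⊤ : Subgroup (QuaternionGroup 3)) 1 g = 1 := by
  classical
  obtain ⟨c1, c2, c3, c4, -⟩ := natCard_subgroups_dicyclicThree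
  refine ⟨?_, ?_, ?_, ?_, ?_, ?_⟩
  · rw [indClassFun_one_apply_eq_div, card_conj_mem_bot, Subgroup.card_bot, QuaternionGroup.card]
    split_ifs <;> norm_num
  · rw [indClassFun_one_apply_eq_div, card_conj_mem_center_dicyclicThree, c1]
    split_ifs <;> norm_num
  · rw [indClassFun_one_apply_eq_div, card_conj_mem_aSq_dicyclicThree, c2]
    split_ifs <;> norm_num
  · rw [indClassFun_one_apply_eq_div, card_conj_mem_xa_dicyclicThree, c3]
    split_ifs <;> norm_num
  · rw [indClassFun_one_apply_eq_div, card_conj_mem_a_dicyclicThree, c4]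
    split_ifs <;> norm_num
  · rw [indClassFun_top_one, Pi.one_apply]

end DicyclicThreeMarks

/-! ## §3 The class equations; `Θ_inf` -/

section DicyclicThreeRelations

/-- The twelve elements. [folklore] -/
private theorem dicyclicThree_cases (g : QuaternionGroup 3) :
    g = a 0 ∨ g = a 1 ∨ g = a 2 ∨ g = a 3 ∨ g = a 4 ∨ g = a 5 ∨
      g = xa 0 ∨ g = xa 1 ∨ g = xa 2 ∨ g = xa 3 ∨ g = xa 4 ∨ g = xa 5 := by
  revert g
  decide

/-- The signed-sum test on `![1, Z, C_3, C_4, C_6, G]`, pointwise. [cite: BartelDokchitser2015, §1.1] -/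
theorem sum_smul_indClassFun_dicyclicThree_apply (c : Fin 6 → ℤ) (g : QuaternionGroup 3) :
    (∑ i : Fin 6, (c i : ℂ) • indClassFun ((![⊥,
        Subgroup.zpowers (a 3 : QuaternionGroup 3),
        Subgroup.zpowers (a 2 : QuaternionGroup 3),
        Subgroup.zpowers (xa 0 : QuaternionGroup 3),
        Subgroup.zpowers (a 1 : QuaternionGroup 3),
        ⊤] :
        Fin 6 → Subgroup (QuaternionGroup 3)) i) 1) g =
      c 0 * (if g = 1 then (12 : ℂ) else 0) + c 1 * (if g ^ 2 = 1 then (6 : ℂ) else 0) +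
        c 2 * (if g ^ 3 = 1 then (4 : ℂ) else 0) + c 3 * (if g ^ 2 = 1 then (3 : ℂ) else if g ^ 2 = a 3 then 1 else 0) +
        c 4 * (if g ^ 6 = 1 then (2 : ℂ) else 0) + c 5 := by
  obtain ⟨h0, h1, h2, h3, h4, h5⟩ := indClassFun_one_apply_dicyclicThree g
  simp only [Finset.sum_apply, Pi.smul_apply, smul_eq_mul, Fin.sum_univ_six]
  show (c 0 : ℂ) * indClassFun (⊥ : Subgroup (QuaternionGroup 3)) 1 g +
      (c 1 : ℂ) * indClassFun (Subgroup.zpowers (a 3 : QuaternionGroup 3)) 1 g +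
      (c 2 : ℂ) * indClassFun (Subgroup.zpowers (a 2 : QuaternionGroup 3)) 1 g +
      (c 3 : ℂ) * indClassFun (Subgroup.zpowers (xa 0 : QuaternionGroup 3)) 1 g +
      (c 4 : ℂ) * indClassFun (Subgroup.zpowers (a 1 : QuaternionGroup 3)) 1 g +
      (c 5 : ℂ) * indClassFun (⊤ : Subgroup (QuaternionGroup 3)) 1 g = _
  rw [h0, h1, h2, h3, h4, h5, mul_one]

/-- **The Brauer relations of `Dic_3`**: `c ∈ K(Dic_3)` iff `c_1 = 0`, `c_Z = −c_{C_6}`, `c_{C_3} = 0`,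
`c_{C_4} = 2c_{C_6}`, `c_G = −2c_{C_6}` (one free coordinate: rank `1`, the single non-cyclic class `G`) — the class
equations at `1, a³, a², a, x` solved. [cite: BartelDokchitser2015, §1.1; §2 ("the rank of K(G) is the number of conjugacy classes of non-cyclic subgroups")] -/
theorem sum_smul_indClassFun_dicyclicThree_eq_zero_iff (c : Fin 6 → ℤ) :
    ∑ i : Fin 6, (c i : ℂ) • indClassFun ((![⊥,
        Subgroup.zpowers (a 3 : QuaternionGroup 3),
        Subgroup.zpowers (a 2 : QuaternionGroup 3),
        Subgroup.zpowers (xa 0 : QuaternionGroup 3),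
        Subgroup.zpowers (a 1 : QuaternionGroup 3),
        ⊤] :
        Fin 6 → Subgroup (QuaternionGroup 3)) i) 1 = 0 ↔
      c 0 = 0 ∧ c 1 = -c 4 ∧ c 2 = 0 ∧ c 3 = 2 * c 4 ∧ c 5 = -2 * c 4 := by
  constructor
  · intro h
    have e := fun g ↦ (sum_smul_indClassFun_dicyclicThree_apply c g).symm.trans (congr_fun h g)
    have e0 := e 1
    have e1 := e (a 3)
    have e2 := e (a 2)
    have e3 := e (a 1)
    have e4 := e (xa 0)
    simp (config := { decide := true }) only [Pi.zero_apply, if_true, if_false, mul_zero, add_zero] at e0 e1 e2 e3 e4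
    have i0 : ((12 * c 0 + 6 * c 1 + 4 * c 2 + 3 * c 3 + 2 * c 4 + c 5 : ℤ) : ℂ) = 0 := by
      push_cast; linear_combination e0
    have i1 : ((6 * c 1 + 3 * c 3 + 2 * c 4 + c 5 : ℤ) : ℂ) = 0 := by push_cast; linear_combination e1
    have i2 : ((4 * c 2 + 2 * c 4 + c 5 : ℤ) : ℂ) = 0 := by push_cast; linear_combination e2
    have i3 : ((2 * c 4 + c 5 : ℤ) : ℂ) = 0 := by push_cast; linear_combination e3
    have i4 : ((c 3 + c 5 : ℤ) : ℂ) = 0 := by push_cast; linear_combination e4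
    norm_cast at i0 i1 i2 i3 i4
    omega
  · rintro ⟨h0, h1, h2, h3, h5⟩
    funext g
    rw [sum_smul_indClassFun_dicyclicThree_apply, Pi.zero_apply, h0, h1, h2, h3, h5]
    push_cast
    rcases dicyclicThree_cases g with rfl | rfl | rfl | rfl | rfl | rfl | rfl | rfl | rfl | rfl | rfl | rfl <;>
    · simp (config := { decide := true }) only [if_true, if_false]
      ring

/-- **`Θ_inf = Z − 2C_4 − C_6 + 2G` is a relation** — the lift from `Dic_3/Z ≅ S_3` of `1 − 2C_2 − C_3 + 2S_3`.
[cite: BartelDokchitser2015, §2 (Inflation; Example 2)] -/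
theorem thetaInf_mem_dicyclicThree :
    ∑ i : Fin 6, (((![0, 1, 0, -2, -1, 2] : Fin 6 → ℤ) i : ℤ) : ℂ) • indClassFun ((![⊥,
        Subgroup.zpowers (a 3 : QuaternionGroup 3),
        Subgroup.zpowers (a 2 : QuaternionGroup 3),
        Subgroup.zpowers (xa 0 : QuaternionGroup 3),
        Subgroup.zpowers (a 1 : QuaternionGroup 3),
        ⊤] :
        Fin 6 → Subgroup (QuaternionGroup 3)) i) 1 = 0 :=
  (sum_smul_indClassFun_dicyclicThree_eq_zero_iff _).2 (by simp)

/-- **`(1_Z)^G + 2(1_G)^G = 2(1_{C_4})^G + (1_{C_6})^G`** — `Θ_inf` as an identity of permutation characters (its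
Kani–Rosen isogeny `B_Z × B_G² ∼ B_{C_4}² × B_{C_6}` is, three-fold, the companion's `isIsogenous_dicyclic_of_odd`).
[cite: BartelDokchitser2015, §2 (Inflation; Example 2)] -/
theorem indClassFun_center_add_two_top_eq_dicyclicThree :
    indClassFun (Subgroup.zpowers (a 3 : QuaternionGroup 3)) 1 + (2 : ℂ) • indClassFun (⊤ : Subgroup (QuaternionGroup 3)) 1 =
      (2 : ℂ) • indClassFun (Subgroup.zpowers (xa 0 : QuaternionGroup 3)) 1 +
        indClassFun (Subgroup.zpowers (a 1 : QuaternionGroup 3)) 1 := by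
  funext g
  obtain ⟨-, h1, -, h3, h4, h5⟩ := indClassFun_one_apply_dicyclicThree g
  simp only [Pi.add_apply, Pi.smul_apply, smul_eq_mul]
  rw [h1, h3, h4, h5]
  rcases dicyclicThree_cases g with rfl | rfl | rfl | rfl | rfl | rfl | rfl | rfl | rfl | rfl | rfl | rfl <;>
  · simp (config := { decide := true }) only [if_true, if_false]
    norm_num

end DicyclicThreeRelations

/-! ## §4 `K(Dic_3) = ℤ·Θ_inf`, rank `1` -/

section DicyclicThreeLattice

variable (𝒦 : Submodule ℤ (Fin 6 → ℤ))
  (h𝒦 : ∀ c : Fin 6 → ℤ, c ∈ 𝒦 ↔ ∑ i : Fin 6, (c i : ℂ) • indClassFun ((![⊥,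
        Subgroup.zpowers (a 3 : QuaternionGroup 3),
        Subgroup.zpowers (a 2 : QuaternionGroup 3),
        Subgroup.zpowers (xa 0 : QuaternionGroup 3),
        Subgroup.zpowers (a 1 : QuaternionGroup 3),
        ⊤] :
        Fin 6 → Subgroup (QuaternionGroup 3)) i) 1 = 0)
include h𝒦

/-- **Membership in `K(Dic_3)` in coordinates.** [cite: BartelDokchitser2015, §1.1; §2] -/
theorem mem_brauerRelations_dicyclicThree_iff (c : Fin 6 → ℤ) :
    c ∈ 𝒦 ↔ c 0 = 0 ∧ c 1 = -c 4 ∧ c 2 = 0 ∧ c 3 = 2 * c 4 ∧ c 5 = -2 * c 4 :=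
  (h𝒦 c).trans (sum_smul_indClassFun_dicyclicThree_eq_zero_iff c)

/-- **Every relation of `Dic_3` is `(−c_{C_6})·Θ_inf`.** [cite: BartelDokchitser2015, §2 (rank; Inflation)] -/
theorem eq_smul_thetaInf_of_mem_brauerRelations_dicyclicThree {c : Fin 6 → ℤ} (hc : c ∈ 𝒦) :
    c = (-c 4) • (![0, 1, 0, -2, -1, 2] : Fin 6 → ℤ) := by
  obtain ⟨h0, h1, h2, h3, h5⟩ := (mem_brauerRelations_dicyclicThree_iff 𝒦 h𝒦 c).1 hc
  funext i
  fin_cases i <;> simp <;> omega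

/-- **`K(Dic_3) = ℤ·Θ_inf`** — every relation imprimitive (`Prim(Dic_3) = 0`). [cite: BartelDokchitser2015, §2 (Inflation); §1.1 Theorem A] -/
theorem brauerRelations_dicyclicThree_eq_span_singleton :
    𝒦 = Submodule.span ℤ {(![0, 1, 0, -2, -1, 2] : Fin 6 → ℤ)} := by
  refine le_antisymm (fun c hc ↦ ?_) ((Submodule.span_singleton_le_iff_mem _ _).2 ((h𝒦 _).2 thetaInf_mem_dicyclicThree))
  rw [eq_smul_thetaInf_of_mem_brauerRelations_dicyclicThree 𝒦 h𝒦 hc]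
  exact Submodule.smul_mem _ _ (Submodule.mem_span_singleton_self _)

omit h𝒦 in
/-- The canonical lattice `K(Dic_3) = ker(c ↦ Σ_i c_i (1_{H_i})^G) = ℤ·Θ_inf`. [cite: BartelDokchitser2015, §2] -/
theorem ker_linearCombination_indClassFun_one_dicyclicThree_eq_span :
    LinearMap.ker (Fintype.linearCombination ℤ fun i : Fin 6 ↦ indClassFun ((![⊥,
        Subgroup.zpowers (a 3 : QuaternionGroup 3),
        Subgroup.zpowers (a 2 : QuaternionGroup 3),
        Subgroup.zpowers (xa 0 : QuaternionGroup 3),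
        Subgroup.zpowers (a 1 : QuaternionGroup 3),
        ⊤] :
        Fin 6 → Subgroup (QuaternionGroup 3)) i) 1) =
      Submodule.span ℤ {(![0, 1, 0, -2, -1, 2] : Fin 6 → ℤ)} :=
  brauerRelations_dicyclicThree_eq_span_singleton _ (mem_ker_linearCombination_indClassFun_one_iff _)

omit h𝒦 in
/-- `{Θ_inf}` is linearly independent. [cite: BartelDokchitser2015, §2 ("clearly linearly independent")] -/
theorem linearIndependent_thetaInf_dicyclicThree :
    LinearIndependent ℤ (![(![0, 1, 0, -2, -1, 2] : Fin 6 → ℤ)] : Fin 1 → Fin 6 → ℤ) := by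
  rw [Fintype.linearIndependent_iff]
  intro c hc i
  have h1 := congr_fun hc 1
  simp at h1
  fin_cases i
  simpa using h1

omit h𝒦 in
/-- **`rank K(Dic_3) = 1`** (on the canonical lattice) — the one class of non-cyclic subgroups, `G` itself.
[cite: BartelDokchitser2015, §2 ("the rank of K(G) is the number of conjugacy classes of non-cyclic subgroups")] -/
theorem finrank_ker_linearCombination_indClassFun_one_dicyclicThree :
    Module.finrank ℤ (LinearMap.ker (Fintype.linearCombination ℤ fun i : Fin 6 ↦ indClassFun ((![⊥,
        Subgroup.zpowers (a 3 : QuaternionGroup 3),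
        Subgroup.zpowers (a 2 : QuaternionGroup 3),
        Subgroup.zpowers (xa 0 : QuaternionGroup 3),
        Subgroup.zpowers (a 1 : QuaternionGroup 3),
        ⊤] :
        Fin 6 → Subgroup (QuaternionGroup 3)) i) 1)) = 1 := by
  rw [ker_linearCombination_indClassFun_one_dicyclicThree_eq_span]
  have h := linearIndependent_thetaInf_dicyclicThree
  rw [show ({(![0, 1, 0, -2, -1, 2] : Fin 6 → ℤ)} : Set (Fin 6 → ℤ)) =
      Set.range (![(![0, 1, 0, -2, -1, 2] : Fin 6 → ℤ)] : Fin 1 → Fin 6 → ℤ) by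
    ext v
    simp only [Set.mem_singleton_iff, Set.mem_range]
    constructor
    · rintro rfl
      exact ⟨0, rfl⟩
    · rintro ⟨i, rfl⟩
      fin_cases i
      rfl]
  rw [finrank_span_eq_card h, Fintype.card_fin]

end DicyclicThreeLattice

end AbelianVariety

end Literature.AlgebraicGeometry.Motives
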